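import Summits.AtomisticToContinuum.HydrodynamicLimit.Theorems.JParityClosureLocalSecondLawThermalHeatFluxRegularity

/-!
# P3 from the cubic heat-flux closure — the conditional form of `stub_passivityThermal`
(stmt-AtomisticToContinuum-13081, line `exact-entropy-ledger-three-passivities`; file 3 of 3 of the thermal package)

The registered stub `stub_passivityThermal` (P3: `P(Regular ∧ T₃ < −η) ≤ δ` eventually, in the crux's frame;
`T₃ = T₃kin + T₃coll` the heat-current pairing `∫∫∇(φ/θ_r)·(q^kin_r + q^c_r)` of the ledger) is, as registered, open
mathematics: its kinetic half is the WEAK-FORM CUBIC heat-flux closure (N1) and its collisional half the vanishing of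
the J-even collisional energy transfer (N2); both Bochner integrals of `T₃kin` are honest on `Regular`
(`T3kin_honest_of_regular`) and `T₃coll` is a finite sum there, so no junk escape exists.  This file isolates three
in-probability inputs from which P3 follows by the deterministic core `abs_T3kin_le_of_regular` and a union bound, all
written in the crux's own frame and INLINED as the three hypotheses of the theorem (their Lean texts are displayed
below, ready to be registered as stubs `CubicHeatFluxRate`, `ThermalStrainTightness`, `CollisionalHeatLaw` of the crux;
no `def … : Prop` is introduced here):

* `CubicHeatFluxRate` — on the regular event `∫₀^τ∫ ‖q^kin_r‖ ≤ η r` with probability `≥ 1 − δ` (`L¹`-smallness of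
  the CUBIC coarse peculiar moment at rate `r`).  Pre-shock ⟸ local Maxwellisation (13078 + 13080 + 13086 + 13085 +
  13083 ⇒ 13084; a centred Maxwellian has zero cubic moment) + a CUBIC uniform-integrability input
  (EnergyCurrentTails stmt-9235 of route KineticWindows); KineticEnergyTails (13087) is insufficient (the `c/V³`
  stream: tail energy `c/(2V) → 0`, tail energy FLUX `c/2`).
* `ThermalStrainTightness` — `r|∂ₖθ_r| ≤ K` on `[0,τ] × 𝕋³` with probability `≥ 1 − δ` (the thermal analogue of P1's
  `StrainTightness`; deterministic on `Regular` only with the crude `L_θ ∝ r⁻¹⁰` of `abs_pD_thetaC_le_of_floor`, at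
  rate `1/r` under a local energy cap, and an LLN-type statement pre-shock).
* `CollisionalHeatLaw` — `P(Regular ∧ |T₃coll| > η) ≤ δ`: the EvenStressEnskog-type law (13079 machinery) for the
  energy-transfer mark `Ξ_q = (a/2)n̂⟨v⁻+w⁻−2u_r, n̂⟩`, whose Enskog value is `0` by the reflection
  `(c₁, c₂, n̂) ↦ (−c₁, −c₂, −n̂)`; stated WITH the `φ`-weight (honest, still informative: the finite-net step to fixed
  weights is crux-3-sized, as for P2's `CollisionalWorkEnskogLaw`).

`passivityThermal_of_closure : CubicHeatFluxRate → ThermalStrainTightness → CollisionalHeatLaw → stub_passivityThermal`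
(all four texts verbatim).  The pair (rate `r`, tightness `K/r`) can be traded for (rate `1`, tightness `K`) without
changing the proof; the registered pairing follows P1's.

References: H. Spohn, *Large Scale Dynamics of Interacting Particles* (1991), Part I §3; R. J. Hardy, J. Chem.
Phys. 76 (1982) 622; H. van Beijeren, M. H. Ernst, Physica 68 (1973) 437 (Enskog collisional transfer);
S. Olla, S. R. S. Varadhan, H.-T. Yau, Commun. Math. Phys. 155 (1993) 523 (local-equilibrium closures).
-/

noncomputable section

namespace Summit.AtomisticToContinuum.HydrodynamicLimit.Theorems.LocalSecondLawLedger

open scoped BigOperators Topology Classical MeasureTheory ENNReal InnerProductSpace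
open Filter Set MeasureTheory
open Literature.MathematicalPhysics.KineticTheory
open Literature.Analysis.FluidPDE
open Summit.AtomisticToContinuum.HydrodynamicLimit.Theorems.LocalSecondLawNegative

variable {N : ℕ}

/-- The arithmetic of the kinetic half: with `A = M'/c + MK/c²`, level `η' = η/(6(A+1))` and `r ≤ 1`,
`3(M'/c + MK/(rc²)) · (η' r) < η/2`. -/
theorem psvT_rate_arith {M M' K c r η : ℝ} (hM : 0 ≤ M) (hM' : 0 ≤ M') (hK : 0 ≤ K) (hc : 0 < c) (hr : 0 < r)
    (hr1 : r ≤ 1) (hη : 0 < η) :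
    3 * (M' / c + M * K / (r * c ^ 2)) * (η / (6 * (M' / c + M * K / c ^ 2 + 1)) * r) < η / 2 := by
  set A : ℝ := M' / c + M * K / c ^ 2 with hA
  have hA0 : 0 ≤ A := by rw [hA]; positivity
  have h2 : 3 * (M' / c + M * K / (r * c ^ 2)) * (η / (6 * (A + 1)) * r) =
      η / (2 * (A + 1)) * (M' * r / c + M * K / c ^ 2) := by
    field_simp
    ring
  have h3 : M' * r / c + M * K / c ^ 2 ≤ A := by
    rw [hA]
    have : M' * r / c ≤ M' / c := by
      rw [div_le_div_iff_of_pos_right hc]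
      exact mul_le_of_le_one_right hM' hr1
    linarith
  have h4 : η / (2 * (A + 1)) * (M' * r / c + M * K / c ^ 2) ≤ η / (2 * (A + 1)) * A :=
    mul_le_mul_of_nonneg_left h3 (by positivity)
  have h5 : η / (2 * (A + 1)) * A < η / 2 := by
    rw [div_mul_eq_mul_div, div_lt_div_iff₀ (by positivity) (by norm_num)]
    nlinarith
  rw [h2]
  exact h4.trans_lt h5

/-! ### Antecedent `CubicHeatFluxRate` (inlined as the first hypothesis of `passivityThermal_of_closure`)
**`L¹`-smallness of the coarse kinetic heat current at rate `r`** (in probability, on the regular event) — the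
antecedent about the CUBIC peculiar moment `q^kin_r = (N+1)⁻¹∑ᵢ b_r(xᵢ,·)|vᵢ−u_r|²/2 (vᵢ−u_r)`.  In the crux's frame:
for every floor/cap `(c, η₁)` and `η, δ > 0`, for `r < r₀` and `N ≥ N₀(r)`, outside an event of probability `≤ δ` the
regular orbits satisfy `∫₀^τ∫ ‖q^kin_r‖ ≤ η r`.  PRE-SHOCK producers on the board: local Maxwellisation —
OddContactSymmetry (13078) + RateFloor (13080) + EmpiricalEnskogIdentity (13086) + CollisionTightness (13085) +
ParitySplit (13083) ⇒ vanishing even production ⇒ ParityRigidity (13084): the one-particle law is locally Maxwellian,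
and a centred Maxwellian has ZERO cubic moment `∫|c|²c M(c) dc = 0` — upgraded from the velocity LAW to the cubic
STATISTIC by a CUBIC uniform-integrability input: EnergyCurrentTails (stmt-9235, route KineticWindows; cubic UI
pre-shock).  KineticEnergyTails (13087) alone is INSUFFICIENT — the `c/V³` stream: put a fraction `c/V³` of the
particles of a ball at peculiar speed `V → ∞`; their kinetic-energy share `(c/V³)(V²/2) = c/(2V) → 0` (quadratic UI
holds) but their heat-flux share `(c/V³)(V³/2) = c/2 ↛ 0`.  The RESOLVED part of `q^kin_r` (shear across the ball,
`u(xᵢ) − u_r(x₀) = O(r‖∇u‖)`) is `O(r²)` after the odd-in-`(xᵢ−x₀)` cancellation of its linear term, `= o(r)`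
(DensityCap 13082 keeps the cutoffs off).  Post-shock it is the line's bet (Fourier: `q ∥ −∇θ`).  Lean text
(namespace/opens of this file), ready to be registered as a stub:
```
∀ (a₀ θ₀ : T3 → ℝ) (u₀ : T3 → V3), Continuous a₀ → Continuous θ₀ → Continuous u₀ → (∀ x, 0 < a₀ x) → (∀ x, 0 < θ₀ x)
→ ∃ σ₀ : ℝ, 0 < σ₀ ∧ ∀ σ : ℝ, 0 < σ → σ < σ₀ → ∀ (T : ℝ) (ρ θ : ℝ → T3 → ℝ) (u : ℝ → T3 → V3),
IsHardSphereEulerSolution σ T ρ u θ → ∀ Φ : (N : ℕ) → Flow σ N, TendstoHydroFieldsAt (fun N => localGibbsLaw σ a₀ u₀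
θ₀ N (Φ N)) Φ ρ u θ 0 → 0 < T → ∀ τ : ℝ, 0 < τ → ∀ c η₁ : ℝ, 0 < c → ∀ η δ : ℝ, 0 < η → 0 < δ → ∃ r₀ : ℝ, 0 < r₀ ∧ ∀
r : ℝ, 0 < r → r < r₀ → ∃ N₀ : ℕ, ∀ N : ℕ, N₀ ≤ N → localGibbsLaw σ a₀ u₀ θ₀ N (Φ N) {z | Regular σ r τ c η₁ (Φ N) z
∧ η * r < ∫ s in Set.Icc (0 : ℝ) τ, ∫ x : T3, ‖qkinC r ((Φ N).flow s z) x‖} ≤ ENNReal.ofReal δ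
```
-/


/-! ### Antecedent `ThermalStrainTightness` (inlined as the second hypothesis of `passivityThermal_of_closure`)
**Tightness of the resolved temperature gradient at rate `1/r`** (in probability, on the regular event) — the
antecedent about the weight `∇(φ/θ_r) = ∇φ/θ_r − φ∇θ_r/θ_r²`.  In the crux's frame: for every floor/cap `(c, η₁)` and
`δ > 0` there is `K > 0` such that for `r < r₀`, `N ≥ N₀(r)`, outside an event of probability `≤ δ` the regular orbits
satisfy `r|∂ₖθ_r(s, x)| ≤ K` on `[0,τ] × 𝕋³` (the crux's pointwise, junk-valued `pD`: where `θ_r` is not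
line-differentiable `pD k θ_r = 0` costs nothing, and there `∂ₖ(φ/θ_r)` is junk too — `abs_pD_div_le`).  On `Regular`
ALONE it is deterministic only with the crude constant `L_θ(r, c, ke) ∝ (1+ke)³/(c³r¹⁰)` of
`abs_pD_thetaC_le_of_floor` (one fast particle near the rim of the ball); with a local energy cap `e_r ≤ E` in the
regular event it is deterministic at the right rate `C(c, η₁/σ³, E)/r` (the cone derivative `3/(πr⁴)𝟙_{d<r}` weighs
`O((η₁/σ³)r³)` particles), exactly as P1's `StrainTightness`; pre-shock it also follows (with `K` independent of `r`,
even `r|∇θ_r| → 0`) from the law of large numbers for the three cone fields at positive times (the fixed-time field LLN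
behind F, HydroLimitInBand stmt-9133-type, with KineticEnergyTails 13087 for the energy field).  Lean text, ready to be
registered as a stub:
```
∀ (a₀ θ₀ : T3 → ℝ) (u₀ : T3 → V3), Continuous a₀ → Continuous θ₀ → Continuous u₀ → (∀ x, 0 < a₀ x) → (∀ x, 0 < θ₀ x)
→ ∃ σ₀ : ℝ, 0 < σ₀ ∧ ∀ σ : ℝ, 0 < σ → σ < σ₀ → ∀ (T : ℝ) (ρ θ : ℝ → T3 → ℝ) (u : ℝ → T3 → V3),
IsHardSphereEulerSolution σ T ρ u θ → ∀ Φ : (N : ℕ) → Flow σ N, TendstoHydroFieldsAt (fun N => localGibbsLaw σ a₀ u₀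
θ₀ N (Φ N)) Φ ρ u θ 0 → 0 < T → ∀ τ : ℝ, 0 < τ → ∀ c η₁ : ℝ, 0 < c → ∀ δ : ℝ, 0 < δ → ∃ K : ℝ, 0 < K ∧ ∃ r₀ : ℝ, 0 <
r₀ ∧ ∀ r : ℝ, 0 < r → r < r₀ → ∃ N₀ : ℕ, ∀ N : ℕ, N₀ ≤ N → localGibbsLaw σ a₀ u₀ θ₀ N (Φ N) {z | Regular σ r τ c η₁
(Φ N) z ∧ ∃ s ∈ Set.Icc (0 : ℝ) τ, ∃ x : T3, ∃ k : Fin 3, K < r * |pD k (fun y => thetaC r ((Φ N).flow s z) y) x|} ≤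
ENNReal.ofReal δ
```
-/


/-! ### Antecedent `CollisionalHeatLaw` (inlined as the third hypothesis of `passivityThermal_of_closure`)
**The collisional heat transfer vanishes in probability on the regular event** — an EvenStressEnskog-type law with
Enskog value ZERO, stated WITH the test-function weight (P3's own frame; the finite-net / equicontinuity step from
the `φ`-weighted statistic to fixed smooth weights is crux-3-sized, exactly as for P2's `CollisionalWorkEnskogLaw`, and
is not attempted here): `P( Regular ∧ |T₃coll| > η ) ≤ δ` for `r < r₀`, `N ≥ N₀(r)`.  `T₃coll` is the ordered-pair
collision statistic (`collSum`, an honest finite sum on good orbits) of the ENERGY-TRANSFER mark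
`Ξ_q = (a/2) n̂ ⟨v⁻ + w⁻ − 2u_r(x₀), n̂⟩` — the energy `Δ(|vᵢ − u_r|²/2) = a⟨n̂, vᵢ⁻ + (a/2)n̂ − u_r⟩ = (a/2)⟨v⁻+w⁻−2u_r, n̂⟩`
transferred TO `i` in the frame `u_r(x₀)` (`Δvᵢ = a n̂`, `vel_sub_leftLim_eq_impulse_smul_nrm`; J-even: invariant under
the pair swap `(n̂, v⁻, w⁻) ↦ (−n̂, w⁻, v⁻)`, whence the `½`) — with the configuration-dependent weights
`½ ∫ ∑ₖ ∂ₖ(φ/θ_r) b̄ᵢⱼ n̂ₖ dx` (bounded by `3(M'/c + MK/(rc²))` off the thermal-strain event).  ITS ENSKOG VALUE IS ZERO: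
the local-Maxwellian contact law is invariant under the joint reflection `(c₁, c₂, n̂) ↦ (−c₁, −c₂, −n̂)` of peculiar
velocities and normal, which fixes `a = ((w−v)·n̂)₊` and flips `Ξ_q`.  Producers: the even-mark machinery of
EvenStressEnskog (crux stmt-13079) run for `Ξ_q` instead of `Ξ_P` (+ CollisionTightness 13085, RateFloor 13080), then
the net over the weights.  OPEN.  Lean text, ready to be registered as a stub:
```
∀ (a₀ θ₀ : T3 → ℝ) (u₀ : T3 → V3), Continuous a₀ → Continuous θ₀ → Continuous u₀ → (∀ x, 0 < a₀ x) → (∀ x, 0 < θ₀ x)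
→ ∃ σ₀ : ℝ, 0 < σ₀ ∧ ∀ σ : ℝ, 0 < σ → σ < σ₀ → ∀ (T : ℝ) (ρ θ : ℝ → T3 → ℝ) (u : ℝ → T3 → V3),
IsHardSphereEulerSolution σ T ρ u θ → ∀ Φ : (N : ℕ) → Flow σ N, TendstoHydroFieldsAt (fun N => localGibbsLaw σ a₀ u₀
θ₀ N (Φ N)) Φ ρ u θ 0 → 0 < T → ∀ τ : ℝ, 0 < τ → ∀ φ : ℝ → T3 → ℝ,
Literature.Analysis.FunctionSpaces.Torus.IsSmoothSpaceTimeOn Set.univ φ → (∀ s x, 0 ≤ φ s x) → (∃ τ' : ℝ, τ' < τ ∧ ∀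
s, τ' ≤ s → ∀ x, φ s x = 0) → ∀ c η₁ : ℝ, 0 < c → ∀ η δ : ℝ, 0 < η → 0 < δ → ∃ r₀ : ℝ, 0 < r₀ ∧ ∀ r : ℝ, 0 < r → r
< r₀ → ∃ N₀ : ℕ, ∀ N : ℕ, N₀ ≤ N → localGibbsLaw σ a₀ u₀ θ₀ N (Φ N) {z | Regular σ r τ c η₁ (Φ N) z ∧ η < |T₃coll σ
r τ φ (Φ N) z|} ≤ ENNReal.ofReal δ
```
-/


/-- **P3 from the cubic heat-flux closure, thermal strain tightness and the collisional heat law**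
(`passivityThermal_of_closure`): under `CubicHeatFluxRate`, `ThermalStrainTightness` and `CollisionalHeatLaw` (inlined,
in this order) the registered stub `stub_passivityThermal` holds VERBATIM.  Proof: with `M = sup|φ|`, `M' = sup|∇φ|` on
`[0,τ] × 𝕋³` (compactness), `K` from thermal strain tightness at `δ/3`, the cubic rate at level `η/(6(A+1))`,
`A = M'/c + MK/c²`, and `δ/3`, and `r₀ ≤ 1`, the deterministic core `abs_T3kin_le_of_regular` gives
`|T₃kin| ≤ 3(M'/c + MK/(rc²)) · η r/(6(A+1)) ≤ (η/2)·A/(A+1) < η/2` off the first two exceptional events; the collisional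
law at `(η/2, δ/3)` gives `|T₃coll| ≤ η/2` off the third; so `T₃ = T₃kin + T₃coll > −η` there; union bound. -/
theorem passivityThermal_of_closure :
  (∀ (a₀ θ₀ : T3 → ℝ) (u₀ : T3 → V3), Continuous a₀ → Continuous θ₀ → Continuous u₀ → (∀ x, 0 < a₀ x) → (∀ x, 0 < θ₀ x) → ∃ σ₀ : ℝ, 0 < σ₀ ∧ ∀ σ : ℝ, 0 < σ → σ < σ₀ → ∀ (T : ℝ) (ρ θ : ℝ → T3 → ℝ) (u : ℝ → T3 → V3), IsHardSphereEulerSolution σ T ρ u θ → ∀ Φ : (N : ℕ) → Flow σ N, TendstoHydroFieldsAt (fun N => localGibbsLaw σ a₀ u₀ θ₀ N (Φ N)) Φ ρ u θ 0 → 0 < T → ∀ τ : ℝ, 0 < τ → ∀ c η₁ : ℝ, 0 < c → ∀ η δ : ℝ, 0 < η → 0 < δ → ∃ r₀ : ℝ, 0 < r₀ ∧ ∀ r : ℝ, 0 < r → r < r₀ → ∃ N₀ : ℕ, ∀ N : ℕ, N₀ ≤ N → localGibbsLaw σ a₀ u₀ θ₀ N (Φ N) {z | Regular σ r τ c η₁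 (Φ N) z ∧ η * r < ∫ s in Set.Icc (0 : ℝ) τ, ∫ x : T3, ‖qkinC r ((Φ N).flow s z) x‖} ≤ ENNReal.ofReal δ) → (∀ (a₀ θ₀ : T3 → ℝ) (u₀ : T3 → V3), Continuous a₀ → Continuous θ₀ → Continuous u₀ → (∀ x, 0 < a₀ x) → (∀ x, 0 < θ₀ x) → ∃ σ₀ : ℝ, 0 < σ₀ ∧ ∀ σ : ℝ, 0 < σ → σ < σ₀ → ∀ (T : ℝ) (ρ θ : ℝ → T3 → ℝ) (u : ℝ → T3 → V3), IsHardSphereEulerSolution σ T ρ u θ → ∀ Φ : (N : ℕ) → Flow σ N, TendstoHydroFieldsAt (fun N => localGibbsLaw σ a₀ u₀ θ₀ N (Φ N)) Φ ρ u θ 0 → 0 < T → ∀ τ : ℝ, 0 < τ → ∀ c η₁ : ℝ, 0 < c → ∀ δ : ℝ, 0 < δ → ∃ K : ℝ, 0 < K ∧ ∃ r₀ : ℝ, 0 < r₀ ∧ ∀ r : ℝ, 0 < r → r < r₀ → ∃ N₀ : ℕ, ∀ N : ℕ, N₀ ≤ N → localGibbsLaw σ a₀ u₀ θ₀ N (Φ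 N) {z | Regular σ r τ c η₁ (Φ N) z ∧ ∃ s ∈ Set.Icc (0 : ℝ) τ, ∃ x : T3, ∃ k : Fin 3, K < r * |pD k (fun y => thetaC r ((Φ N).flow s z) y) x|} ≤ ENNReal.ofReal δ) → (∀ (a₀ θ₀ : T3 → ℝ) (u₀ : T3 → V3), Continuous a₀ → Continuous θ₀ → Continuous u₀ → (∀ x, 0 < a₀ x) → (∀ x, 0 < θ₀ x) → ∃ σ₀ : ℝ, 0 < σ₀ ∧ ∀ σ : ℝ, 0 < σ → σ < σ₀ → ∀ (T : ℝ) (ρ θ : ℝ → T3 → ℝ) (u : ℝ → T3 → V3), IsHardSphereEulerSolution σ T ρ u θ → ∀ Φ : (N : ℕ) → Flow σ N, TendstoHydroFieldsAt (fun N => localGibbsLaw σ a₀ u₀ θ₀ N (Φ N)) Φ ρ u θ 0 → 0 < T → ∀ τ : ℝ, 0 < τ → ∀ φ : ℝ → T3 → ℝ, Literature.Analysis.FunctionSpaces.Torus.IsSmoothSpaceTimeOn Set.univ φ → (∀ s x, 0 ≤ φ s x) → (∃ τ' : ℝ, τ' < τ ∧ ∀ s, τ' ≤ s → ∀ x, φ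 s x = 0) → ∀ c η₁ : ℝ, 0 < c → ∀ η δ : ℝ, 0 < η → 0 < δ → ∃ r₀ : ℝ, 0 < r₀ ∧ ∀ r : ℝ, 0 < r → r < r₀ → ∃ N₀ : ℕ, ∀ N : ℕ, N₀ ≤ N → localGibbsLaw σ a₀ u₀ θ₀ N (Φ N) {z | Regular σ r τ c η₁ (Φ N) z ∧ η < |T₃coll σ r τ φ (Φ N) z|} ≤ ENNReal.ofReal δ) → ∀ (a₀ θ₀ : T3 → ℝ) (u₀ : T3 → V3), Continuous a₀ → Continuous θ₀ → Continuous u₀ → (∀ x, 0 < a₀ x) → (∀ x, 0 < θ₀ x) → ∃ σ₀ : ℝ, 0 < σ₀ ∧ ∀ σ : ℝ, 0 < σ → σ < σ₀ → ∀ (T : ℝ) (ρ θ : ℝ → T3 → ℝ) (u : ℝ → T3 → V3), IsHardSphereEulerSolution σ T ρ u θ → ∀ Φ : (N : ℕ) → Flow σ N, TendstoHydroFieldsAt (fun N => localGibbsLaw σ a₀ u₀ θ₀ N (Φ N)) Φ ρ u θ 0 → 0 < T → ∀ τ : ℝ, 0 < τ → ∀ φ : ℝ → T3 → ℝ, Literature.Analysis.FunctionSpaces.Torus.IsSmoothSpaceTimeOn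 Set.univ φ → (∀ s x, 0 ≤ φ s x) → (∃ τ' : ℝ, τ' < τ ∧ ∀ s, τ' ≤ s → ∀ x, φ s x = 0) → ∀ c η₁ : ℝ, 0 < c → ∀ η δ : ℝ, 0 < η → 0 < δ → ∃ r₀ : ℝ, 0 < r₀ ∧ ∀ r : ℝ, 0 < r → r < r₀ → ∃ N₀ : ℕ, ∀ N : ℕ, N₀ ≤ N → localGibbsLaw σ a₀ u₀ θ₀ N (Φ N) {z | Regular σ r τ c η₁ (Φ N) z ∧ T₃ σ r τ φ (Φ N) z < -η} ≤ ENNReal.ofReal δ := by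
  intro hQ hΘ hC a₀ θ₀ u₀ ha hθ hu ha0 hθ0
  obtain ⟨σ₁, hσ₁, H1⟩ := hQ a₀ θ₀ u₀ ha hθ hu ha0 hθ0
  obtain ⟨σ₂, hσ₂, H2⟩ := hΘ a₀ θ₀ u₀ ha hθ hu ha0 hθ0
  obtain ⟨σ₃, hσ₃, H3⟩ := hC a₀ θ₀ u₀ ha hθ hu ha0 hθ0
  refine ⟨min (min σ₁ σ₂) σ₃, lt_min (lt_min hσ₁ hσ₂) hσ₃, ?_⟩
  intro σ hσ hσlt T ρ θ u hE Φ h0 hT τ hτ φ hφ hφ0 hsupp c η₁ hc η δ hη hδ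
  have hσ1 : σ < σ₁ := lt_of_lt_of_le hσlt ((min_le_left _ _).trans (min_le_left _ _))
  have hσ2 : σ < σ₂ := lt_of_lt_of_le hσlt ((min_le_left _ _).trans (min_le_right _ _))
  have hσ3 : σ < σ₃ := lt_of_lt_of_le hσlt (min_le_right _ _)
  have hδ3 : 0 < δ / 3 := by positivity
  have hη2 : 0 < η / 2 := by positivity
  -- weight bounds on `[0, τ] × 𝕋³`
  obtain ⟨M, M', hM0, hM'0, hM, hM'⟩ := psvT_phi_bounds hφ τ
  -- thermal strain tightness at `δ/3`
  obtain ⟨K, hK, r₂, hr₂, H2'⟩ := H2 σ hσ hσ2 T ρ θ u hE Φ h0 hT τ hτ c η₁ hc (δ / 3) hδ3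
  -- cubic heat-flux rate at level `η / (6 (A + 1))`, `A = M'/c + MK/c²`, and `δ/3`
  have hη' : 0 < η / (6 * (M' / c + M * K / c ^ 2 + 1)) := by positivity
  obtain ⟨r₁, hr₁, H1'⟩ :=
    H1 σ hσ hσ1 T ρ θ u hE Φ h0 hT τ hτ c η₁ hc (η / (6 * (M' / c + M * K / c ^ 2 + 1))) (δ / 3) hη' hδ3
  -- collisional heat law at `(η/2, δ/3)`
  obtain ⟨r₃, hr₃, H3'⟩ := H3 σ hσ hσ3 T ρ θ u hE Φ h0 hT τ hτ φ hφ hφ0 hsupp c η₁ hc (η / 2) (δ / 3) hη2 hδ3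
  refine ⟨min (min (min r₁ r₂) r₃) 1, lt_min (lt_min (lt_min hr₁ hr₂) hr₃) one_pos, ?_⟩
  intro r hr hrlt
  have hr1 : r < r₁ := lt_of_lt_of_le hrlt ((min_le_left _ _).trans ((min_le_left _ _).trans (min_le_left _ _)))
  have hr2 : r < r₂ := lt_of_lt_of_le hrlt ((min_le_left _ _).trans ((min_le_left _ _).trans (min_le_right _ _)))
  have hr3 : r < r₃ := lt_of_lt_of_le hrlt ((min_le_left _ _).trans (min_le_right _ _))
  have hr1' : r ≤ 1 := (lt_of_lt_of_le hrlt (min_le_right _ _)).le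
  obtain ⟨N₁, HN1⟩ := H1' r hr hr1
  obtain ⟨N₂, HN2⟩ := H2' r hr hr2
  obtain ⟨N₃, HN3⟩ := H3' r hr hr3
  refine ⟨max (max N₁ N₂) N₃, fun N hN => ?_⟩
  have E1 := HN1 N (((le_max_left _ _).trans (le_max_left _ _)).trans hN)
  have E2 := HN2 N (((le_max_right _ _).trans (le_max_left _ _)).trans hN)
  have E3 := HN3 N ((le_max_right _ _).trans hN)
  -- event inclusion: off the three exceptional events the deterministic core gives `T₃ > -η`
  have hsub : {z | Regular σ r τ c η₁ (Φ N) z ∧ T₃ σ r τ φ (Φ N) z < -η} ⊆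
      ({z | Regular σ r τ c η₁ (Φ N) z ∧
          η / (6 * (M' / c + M * K / c ^ 2 + 1)) * r <
            ∫ s in Set.Icc (0 : ℝ) τ, ∫ x : T3, ‖qkinC r ((Φ N).flow s z) x‖} ∪
        {z | Regular σ r τ c η₁ (Φ N) z ∧ ∃ s ∈ Set.Icc (0 : ℝ) τ, ∃ x : T3, ∃ k : Fin 3,
          K < r * |pD k (fun y => thetaC r ((Φ N).flow s z) y) x|}) ∪
        {z | Regular σ r τ c η₁ (Φ N) z ∧ η / 2 < |T₃coll σ r τ φ (Φ N) z|} := by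
    rintro z ⟨hReg, hT3⟩
    by_contra hcon
    have hA' : ¬(η / (6 * (M' / c + M * K / c ^ 2 + 1)) * r <
        ∫ s in Set.Icc (0 : ℝ) τ, ∫ x : T3, ‖qkinC r ((Φ N).flow s z) x‖) :=
      fun h => hcon (Or.inl (Or.inl ⟨hReg, h⟩))
    have hB' : ¬(∃ s ∈ Set.Icc (0 : ℝ) τ, ∃ x : T3, ∃ k : Fin 3,
        K < r * |pD k (fun y => thetaC r ((Φ N).flow s z) y) x|) :=
      fun h => hcon (Or.inl (Or.inr ⟨hReg, h⟩))
    have hC' : ¬(η / 2 < |T₃coll σ r τ φ (Φ N) z|) := fun h => hcon (Or.inr ⟨hReg, h⟩)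
    rw [not_lt] at hA' hC'
    have hKle : ∀ s ∈ Set.Icc (0 : ℝ) τ, ∀ x, ∀ k : Fin 3,
        r * |pD k (fun y => thetaC r ((Φ N).flow s z) y) x| ≤ K :=
      fun s hs x k => not_lt.1 fun h => hB' ⟨s, hs, x, k, h⟩
    have hcore := psvT_abs_T₃kin_le hr hc hτ.le hReg hφ hM hM' hKle
    have hW0 : 0 ≤ 3 * (M' / c + M * K / (r * c ^ 2)) := by positivity
    have h1 : |T₃kin σ r τ φ (Φ N) z| < η / 2 :=
      (hcore.trans (mul_le_mul_of_nonneg_left hA' hW0)).trans_lt (psvT_rate_arith hM0 hM'0 hK.le hc hr hr1' hη)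
    have h2 := neg_abs_le (T₃kin σ r τ φ (Φ N) z)
    have h3 := neg_abs_le (T₃coll σ r τ φ (Φ N) z)
    have h4 : T₃ σ r τ φ (Φ N) z = T₃kin σ r τ φ (Φ N) z + T₃coll σ r τ φ (Φ N) z := rfl
    linarith
  calc localGibbsLaw σ a₀ u₀ θ₀ N (Φ N) {z | Regular σ r τ c η₁ (Φ N) z ∧ T₃ σ r τ φ (Φ N) z < -η}
      ≤ localGibbsLaw σ a₀ u₀ θ₀ N (Φ N)
          (({z | Regular σ r τ c η₁ (Φ N) z ∧
              η / (6 * (M' / c + M * K / c ^ 2 + 1)) * r <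
                ∫ s in Set.Icc (0 : ℝ) τ, ∫ x : T3, ‖qkinC r ((Φ N).flow s z) x‖} ∪
            {z | Regular σ r τ c η₁ (Φ N) z ∧ ∃ s ∈ Set.Icc (0 : ℝ) τ, ∃ x : T3, ∃ k : Fin 3,
              K < r * |pD k (fun y => thetaC r ((Φ N).flow s z) y) x|}) ∪
            {z | Regular σ r τ c η₁ (Φ N) z ∧ η / 2 < |T₃coll σ r τ φ (Φ N) z|}) := measure_mono hsub
    _ ≤ localGibbsLaw σ a₀ u₀ θ₀ N (Φ N)
          ({z | Regular σ r τ c η₁ (Φ N) z ∧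
              η / (6 * (M' / c + M * K / c ^ 2 + 1)) * r <
                ∫ s in Set.Icc (0 : ℝ) τ, ∫ x : T3, ‖qkinC r ((Φ N).flow s z) x‖} ∪
            {z | Regular σ r τ c η₁ (Φ N) z ∧ ∃ s ∈ Set.Icc (0 : ℝ) τ, ∃ x : T3, ∃ k : Fin 3,
              K < r * |pD k (fun y => thetaC r ((Φ N).flow s z) y) x|}) +
        localGibbsLaw σ a₀ u₀ θ₀ N (Φ N)
          {z | Regular σ r τ c η₁ (Φ N) z ∧ η / 2 < |T₃coll σ r τ φ (Φ N) z|} := measure_union_le _ _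
    _ ≤ (ENNReal.ofReal (δ / 3) + ENNReal.ofReal (δ / 3)) + ENNReal.ofReal (δ / 3) :=
        add_le_add ((measure_union_le _ _).trans (add_le_add E1 E2)) E3
    _ = ENNReal.ofReal δ := by
        rw [← ENNReal.ofReal_add hδ3.le hδ3.le, ← ENNReal.ofReal_add (by positivity) hδ3.le, add_thirds]

end Summit.AtomisticToContinuum.HydrodynamicLimit.Theorems.LocalSecondLawLedger

end
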